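import Summits.AtomisticToContinuum.BoseEinsteinCondensation.Theses.BECPhononFloor

/-!
# Route `BECPhononFloor`, assembly item `Assembly` (stmt-AtomisticToContinuum-11456)

Settles the assembly item `stmt-AtomisticToContinuum-11456` of route
`route-AtomisticToContinuum-BECPhononFloor`: the implication
`PhononFloor → MesoscopicTail → FloorModeCounting → BoundaryTransferWeak →
BoseEinsteinCondensation` (the sub-problem statement, by name).

The hypotheses of `Assembly` are, verbatim and in the same order, those of the route's deciding
theorem `closes`, so the assembly is that theorem curried; the composition is spelled out again
below for the record: for a repulsive finite-range `v`, `PhononFloor` and `MesoscopicTail` give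
their bodies for `v`, the support `FloorModeCounting` turns them into torus BEC of near-minimisers
for `v` (the `PeriodicBEC` signature, constant-mode occupation `≥ cN`), and `BoundaryTransferWeak`,
applied per potential, yields `HasGroundStateBEC v ρ` for `0 < ρ < ρ₀(v)`, i.e.
`_root_.BoseEinsteinCondensation`. Pure logic; no analytic content lives here.

References: [LSSY2005, §1.2 (1.16)–(1.19)] (the conjunct), [KennedyLiebShastry1988] (the infrared
bound this route replaces by an order relation).
-/

namespace Summit.AtomisticToContinuum.BoseEinsteinCondensation.Theorems

/-- **Item stmt-AtomisticToContinuum-11456** (`Assembly` of route `BECPhononFloor`, exact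
signature): the four hypotheses of the route's deciding theorem imply the sub-problem statement
`BoseEinsteinCondensation`. Proof: for a repulsive finite-range `v`, `BoundaryTransferWeak v`
applied to the torus BEC of near-minimisers that `FloorModeCounting v` produces from the bodies of
`PhononFloor v` and `MesoscopicTail v`. [folklore] -/
theorem becPhononFloor_assembly_proof :
    Summit.AtomisticToContinuum.BoseEinsteinCondensation.Theses.BECPhononFloor.Assembly := by
  unfold Theses.BECPhononFloor.Assembly
  intro h₁ h₂ h₃ h₄ v hv
  exact h₄ v hv (h₃ v hv (h₁ v hv) (h₂ v hv))

end Summit.AtomisticToContinuum.BoseEinsteinCondensation.Theorems
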